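import Mathlib.Analysis.Calculus.ContDiff.Basic
import Mathlib.Analysis.Calculus.ContDiff.Bounds
import Mathlib.Analysis.Calculus.IteratedDeriv.Lemmas
import Mathlib.Analysis.Normed.Operator.NormedSpace
import HarnessLib

/-!
# Mixed partial derivatives on `ℝ × E` are bounded by the joint iterated derivative

Analysis/Calculus support file (everything proved). For a function `g : ℝ × E → G` of a time
variable and a space variable, `C^n` on an open slab `I × E`, the mixed partial derivative
"`∇ⁱ_ξ ∂ʲ_θ g`" at `(θ₀, ξ₀)`, realised as the `i`-th Fréchet derivative in `ξ` of the `j`-th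
one-variable derivative in `θ`,

  `iteratedFDeriv ℝ i (fun ξ => iteratedDeriv j (fun θ => g (θ, ξ)) θ₀) ξ₀`,

has norm at most `‖iteratedFDeriv ℝ (i + j) g (θ₀, ξ₀)‖` (`i + j ≤ n`):
`norm_iteratedFDeriv_iteratedDeriv_slice_le`. This is the bookkeeping step turning isotropic
bounds on joint derivatives (as produced by differentiation under the integral sign in `(t, x)`)
into the mixed-derivative bounds `‖∇ᵏₓ∂ₜˡ u‖` of parabolic smoothing estimates
(Koch–Nadirashvili–Seregin–Šverák 2009, Prop. 4.1). Ingredients: the space slice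
(`norm_iteratedFDeriv_slice_right_le`: `‖D^i_ξ g(θ₀, ·)(ξ₀)‖ ≤ ‖D^i g(θ₀, ξ₀)‖`, composition with
the isometric embedding `inr`), the time derivative as the joint derivative in the direction
`(1, 0)` (`deriv_slice_left_eq_fderiv`), and `‖D^i (fderiv g)‖ = ‖D^{i+1} g‖`.

## Mathlib / tree search

Mathlib: `ContinuousLinearMap.iteratedFDerivWithin_comp_right/left`, `iteratedFDeriv_comp_add_left`,
`norm_iteratedFDeriv_fderiv`, `Filter.EventuallyEq.iteratedDeriv_eq`,
`ContinuousLinearMap.norm_inr_le_one`; nothing on mixed partials (searched `iteratedDeriv.*iteratedFDeriv`).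
Tree: `Literature.Analysis.FunctionSpaces.norm_iteratedFDeriv_slice_le`
(`SpaceTimeSliceDerivatives.lean`, the space slice for *globally* `C^n` maps) — here the local
(open-set) versions needed on slabs.

## References

* J. Dieudonné, *Foundations of Modern Analysis* (1960), (8.12.8) (partial derivatives as
  restrictions of the total derivative).
-/

noncomputable section

open Set Function Filter Metric
open scoped Topology ContDiff

namespace Literature.Analysis.Calculus

variable {E : Type*} [NormedAddCommGroup E] [NormedSpace ℝ E]
  {G : Type*} [NormedAddCommGroup G] [NormedSpace ℝ G]

/-! ### The space slice -/

/-- **The space slice of a `C^n` map on an open slab**: for `g` `C^n` on `I × E` (`I` open,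
`θ₀ ∈ I`) and `i ≤ n`, `D^i_ξ (g(θ₀, ·))(ξ₀) = D^i g(θ₀, ξ₀) ∘ (inr, …, inr)`. [folklore] -/
theorem iteratedFDeriv_slice_right_eq {g : ℝ × E → G} {I : Set ℝ} (hI : IsOpen I) {n : WithTop ℕ∞}
    (hg : ContDiffOn ℝ n g (I ×ˢ univ)) {θ₀ : ℝ} (hθ₀ : θ₀ ∈ I) {i : ℕ} (hi : (i : WithTop ℕ∞) ≤ n)
    (ξ₀ : E) :
    iteratedFDeriv ℝ i (fun ξ => g (θ₀, ξ)) ξ₀ =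
      (iteratedFDeriv ℝ i g (θ₀, ξ₀)).compContinuousLinearMap
        fun _ => ContinuousLinearMap.inr ℝ ℝ E := by
  -- translate: `h q = g ((θ₀, 0) + q)`, smooth on `U₀ = {q | (θ₀,0) + q ∈ I × E}`
  set U₀ : Set (ℝ × E) := (fun q : ℝ × E => ((θ₀, (0 : E)) : ℝ × E) + q) ⁻¹' (I ×ˢ univ) with hU₀
  have hU₀o : IsOpen U₀ := (hI.prod isOpen_univ).preimage (by fun_prop)
  set h : ℝ × E → G := fun q => g (((θ₀, (0 : E)) : ℝ × E) + q) with hh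
  have hhs : ContDiffOn ℝ n h U₀ := hg.comp (contDiffOn_const.add contDiffOn_id) fun q hq => hq
  have hpre : (ContinuousLinearMap.inr ℝ ℝ E) ⁻¹' U₀ = univ := by
    ext ξ
    simp [hU₀, hθ₀]
  have hmem : ContinuousLinearMap.inr ℝ ℝ E ξ₀ ∈ U₀ := by simp [hU₀, hθ₀]
  have key := (ContinuousLinearMap.inr ℝ ℝ E).iteratedFDerivWithin_comp_right hhs hU₀o.uniqueDiffOn
    (by rw [hpre]; exact uniqueDiffOn_univ) hmem hi
  rw [hpre, iteratedFDerivWithin_univ, iteratedFDerivWithin_of_isOpen i hU₀o hmem] at key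
  have hfun : (h ∘ ContinuousLinearMap.inr ℝ ℝ E) = fun ξ => g (θ₀, ξ) := by
    funext ξ
    simp [hh]
  rw [hfun] at key
  rw [key, hh, iteratedFDeriv_comp_add_left]
  simp

/-- **Norm of the space slice**: `‖D^i_ξ (g(θ₀, ·))(ξ₀)‖ ≤ ‖D^i g(θ₀, ξ₀)‖` (`inr` has norm
`≤ 1`). [folklore] -/
theorem norm_iteratedFDeriv_slice_right_le {g : ℝ × E → G} {I : Set ℝ} (hI : IsOpen I)
    {n : WithTop ℕ∞} (hg : ContDiffOn ℝ n g (I ×ˢ univ)) {θ₀ : ℝ} (hθ₀ : θ₀ ∈ I) {i : ℕ}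
    (hi : (i : WithTop ℕ∞) ≤ n) (ξ₀ : E) :
    ‖iteratedFDeriv ℝ i (fun ξ => g (θ₀, ξ)) ξ₀‖ ≤ ‖iteratedFDeriv ℝ i g (θ₀, ξ₀)‖ := by
  rw [iteratedFDeriv_slice_right_eq hI hg hθ₀ hi ξ₀]
  refine (ContinuousMultilinearMap.norm_compContinuousLinearMap_le _ _).trans ?_
  have h1 : ∏ _i : Fin i, ‖ContinuousLinearMap.inr ℝ ℝ E‖ ≤ 1 := by
    refine Finset.prod_le_one (fun _ _ => norm_nonneg _) fun _ _ => ?_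
    exact ContinuousLinearMap.norm_inr_le_one ℝ ℝ E
  calc ‖iteratedFDeriv ℝ i g (θ₀, ξ₀)‖ * ∏ _i : Fin i, ‖ContinuousLinearMap.inr ℝ ℝ E‖
      ≤ ‖iteratedFDeriv ℝ i g (θ₀, ξ₀)‖ * 1 := mul_le_mul_of_nonneg_left h1 (norm_nonneg _)
    _ = _ := mul_one _

/-! ### The time derivative as a joint derivative -/

/-- **The time derivative of a slice is the joint derivative in the direction `(1, 0)`**:
`d/dθ g(θ, ξ) = Dg(θ, ξ)(1, 0)` at points of differentiability. [folklore] -/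
theorem deriv_slice_left_eq_fderiv {g : ℝ × E → G} {θ : ℝ} {ξ : E}
    (h : DifferentiableAt ℝ g (θ, ξ)) :
    deriv (fun s => g (s, ξ)) θ = fderiv ℝ g (θ, ξ) (1, 0) := by
  have hc : HasFDerivAt (g ∘ fun s : ℝ => (s, ξ))
      ((fderiv ℝ g (θ, ξ)).comp (ContinuousLinearMap.inl ℝ ℝ E)) θ :=
    h.hasFDerivAt.comp θ (hasFDerivAt_prodMk_left (𝕜 := ℝ) θ ξ)
  have hd : HasDerivAt (g ∘ fun s : ℝ => (s, ξ)) (fderiv ℝ g (θ, ξ) (1, 0)) θ := by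
    have := hc.hasDerivAt
    simpa using this
  exact hd.deriv

/-- On an open slab, the iterated time derivatives of the slices of a `C^n` map (`1 ≤ n`) are
the iterated time derivatives of the slices of `q ↦ Dg(q)(1, 0)`, one order lower:
`∂ʲ⁺¹_θ g(·, ξ)(θ₀) = ∂ʲ_θ [Dg(·, ξ)(1,0)](θ₀)`. [folklore] -/
theorem iteratedDeriv_succ_slice_left_eq {g : ℝ × E → G} {I : Set ℝ} (hI : IsOpen I)
    {n : WithTop ℕ∞} (hg : ContDiffOn ℝ n g (I ×ˢ univ)) (hn : 1 ≤ n) {θ₀ : ℝ} (hθ₀ : θ₀ ∈ I)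
    (j : ℕ) (ξ : E) :
    iteratedDeriv (j + 1) (fun θ => g (θ, ξ)) θ₀ =
      iteratedDeriv j (fun θ => fderiv ℝ g (θ, ξ) (1, 0)) θ₀ := by
  rw [iteratedDeriv_succ']
  refine Filter.EventuallyEq.iteratedDeriv_eq j ?_
  filter_upwards [hI.mem_nhds hθ₀] with θ hθ
  have hq : ((θ, ξ) : ℝ × E) ∈ I ×ˢ (univ : Set E) := mk_mem_prod hθ (mem_univ _)
  exact deriv_slice_left_eq_fderiv
    ((hg.differentiableOn (zero_lt_one.trans_le hn).ne').differentiableAt ((hI.prod isOpen_univ).mem_nhds hq))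

/-- The directional derivative `q ↦ Dg(q)(1, 0)` of a `C^n` map is `C^m` for `m + 1 ≤ n` on an
open set. [folklore] -/
theorem contDiffOn_fderiv_apply_const {g : ℝ × E → G} {U : Set (ℝ × E)} (hU : IsOpen U)
    {m n : WithTop ℕ∞} (hg : ContDiffOn ℝ n g U) (hmn : m + 1 ≤ n) (v : ℝ × E) :
    ContDiffOn ℝ m (fun q => fderiv ℝ g q v) U :=
  (hg.fderiv_of_isOpen hU hmn).clm_apply contDiffOn_const

/-- `‖D^k [q ↦ Dg(q)(1,0)] (q₀)‖ ≤ ‖D^{k+1} g (q₀)‖` on an open set of smoothness (`k + 1 ≤ n`):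
evaluation at the unit vector `(1, 0)` has norm `≤ 1`. [folklore] -/
theorem norm_iteratedFDeriv_fderiv_apply_le {g : ℝ × E → G} {U : Set (ℝ × E)} (hU : IsOpen U)
    {n : WithTop ℕ∞} (hg : ContDiffOn ℝ n g U) {k : ℕ} (hk : ((k + 1 : ℕ) : WithTop ℕ∞) ≤ n)
    {q₀ : ℝ × E} (hq₀ : q₀ ∈ U) :
    ‖iteratedFDeriv ℝ k (fun q => fderiv ℝ g q (1, 0)) q₀‖ ≤ ‖iteratedFDeriv ℝ (k + 1) g q₀‖ := by
  set L : ((ℝ × E) →L[ℝ] G) →L[ℝ] G := ContinuousLinearMap.apply ℝ G ((1, 0) : ℝ × E) with hL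
  have hfd : ContDiffOn ℝ k (fderiv ℝ g) U :=
    hg.fderiv_of_isOpen hU (by exact_mod_cast hk)
  have hcomp : (fun q => fderiv ℝ g q (1, 0)) = L ∘ fderiv ℝ g := by
    funext q; simp [hL]
  have key' : iteratedFDeriv ℝ k (L ∘ fderiv ℝ g) q₀ =
      L.compContinuousMultilinearMap (iteratedFDeriv ℝ k (fderiv ℝ g) q₀) :=
    L.iteratedFDeriv_comp_left (hfd.contDiffAt (hU.mem_nhds hq₀)) (i := k) le_rfl
  rw [hcomp, key', ← norm_iteratedFDeriv_fderiv]
  refine (ContinuousLinearMap.norm_compContinuousMultilinearMap_le _ _).trans ?_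
  have hL1 : ‖L‖ ≤ 1 := by
    refine ContinuousLinearMap.opNorm_le_bound _ zero_le_one fun f => ?_
    rw [hL, ContinuousLinearMap.apply_apply, one_mul]
    calc ‖f (1, 0)‖ ≤ ‖f‖ * ‖((1, 0) : ℝ × E)‖ := f.le_opNorm _
      _ ≤ ‖f‖ * 1 := by
          refine mul_le_mul_of_nonneg_left ?_ (norm_nonneg _)
          simp [Prod.norm_def]
      _ = ‖f‖ := mul_one _
  calc ‖L‖ * ‖iteratedFDeriv ℝ k (fderiv ℝ g) q₀‖ ≤ 1 * ‖iteratedFDeriv ℝ k (fderiv ℝ g) q₀‖ :=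
        mul_le_mul_of_nonneg_right hL1 (norm_nonneg _)
    _ = _ := one_mul _

/-! ### The mixed partial bound -/

/-- **Mixed partial derivatives are bounded by the joint iterated derivative.** Let `g` be
`C^n` on the open slab `I × E`, `θ₀ ∈ I`, `i + j ≤ n`. Then
`‖D^i_ξ [ξ ↦ ∂ʲ_θ g(·, ξ)(θ₀)] (ξ₀)‖ ≤ ‖D^{i+j} g (θ₀, ξ₀)‖` (Dieudonné (8.12.8): partial
derivatives are restrictions of total derivatives to coordinate directions, of norm `≤ 1` in
the sup norm of `ℝ × E`). [folklore] -/
theorem norm_iteratedFDeriv_iteratedDeriv_slice_le {g : ℝ × E → G} {I : Set ℝ} (hI : IsOpen I)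
    {n : WithTop ℕ∞} (hg : ContDiffOn ℝ n g (I ×ˢ univ)) {θ₀ : ℝ} (hθ₀ : θ₀ ∈ I) {i j : ℕ}
    (hij : ((i + j : ℕ) : WithTop ℕ∞) ≤ n) (ξ₀ : E) :
    ‖iteratedFDeriv ℝ i (fun ξ => iteratedDeriv j (fun θ => g (θ, ξ)) θ₀) ξ₀‖ ≤
      ‖iteratedFDeriv ℝ (i + j) g (θ₀, ξ₀)‖ := by
  induction j generalizing g n with
  | zero =>
    simp only [iteratedDeriv_zero, Nat.add_zero]
    exact norm_iteratedFDeriv_slice_right_le hI hg hθ₀ (by simpa using hij) ξ₀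
  | succ j ih =>
    have hn1 : (1 : WithTop ℕ∞) ≤ n := le_trans (by exact_mod_cast Nat.le_add_left 1 (i + j)) hij
    -- replace the `(j+1)`-st time derivative of `g` by the `j`-th of `Dg(·)(1,0)`
    have hfun : (fun ξ => iteratedDeriv (j + 1) (fun θ => g (θ, ξ)) θ₀) =
        fun ξ => iteratedDeriv j (fun θ => fderiv ℝ g (θ, ξ) (1, 0)) θ₀ := by
      funext ξ
      exact iteratedDeriv_succ_slice_left_eq hI hg hn1 hθ₀ j ξ
    rw [hfun]
    have hU : IsOpen (I ×ˢ (univ : Set E)) := hI.prod isOpen_univ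
    have hg₁ : ContDiffOn ℝ ((i + j : ℕ) : WithTop ℕ∞) (fun q => fderiv ℝ g q (1, 0)) (I ×ˢ univ) :=
      contDiffOn_fderiv_apply_const hU hg (by exact_mod_cast hij) (1, 0)
    have h1 := ih hg₁ le_rfl
    refine h1.trans ?_
    rw [show i + (j + 1) = (i + j) + 1 by omega]
    exact norm_iteratedFDeriv_fderiv_apply_le hU hg (by exact_mod_cast hij)
      (mk_mem_prod hθ₀ (mem_univ _))

end Literature.Analysis.Calculus

end
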